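import Summits.BirchSwinnertonDyer.BirchSwinnertonDyer.Theorems.PrintCf2SplitBadTwoRestrictedSelmerBottomSelmerToTrueSelmer
import HarnessLib

/-!
# Crux `PrintCf2.SplitBadTwoRankOneOfFacts` (stmt-BirchSwinnertonDyer-20368), road α v10.3, S3c bottom value — THE CANONICAL KUMMER SUBGROUP
# `Q_M = ι_*⁻¹(res_⊤(range κ))` CONTAINS THE `M_r`-COMPONENT OF EVERY KUMMER CLASS: `ι_* e_* (res_⊤ κ(t)) ∈ res_⊤(range κ)`

Cell `bsd-print-cf2`, width seat `bsd-line-cf2-p1-w7` g3 (file 3 of the seat; -w7 g2's lane, memo `Cruxes/…/BOTTOM-VALUE-SNAKE-w7g2-v2.md` §2);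
`--supports stmt-BirchSwinnertonDyer-20368` (helper, Theses-free). HONEST FRAMING: nothing here closes a crux or a stub; BSD is not proved by any of
this; no summit statement is proved by this seat. No definition, no named fact, no `sorry`, no kit. beyond-print theorem: no (bookkeeping).

WHAT. The displayed hypothesis (H2) «`loc_{v̄}(𝔖_v ⊓ L_M) ⊆ loc_{v̄}(Q_M)`» of -w7 g2's `rBV_of_three_factor_values` (p665606) needs elements of
`Q_M := ι_*⁻¹(res_⊤(range κ))` (`κ = kummerMapPInfty`, `ι : M_r = E[𝔮_r^∞] ↪ E[p^∞]`). This file supplies them, GLOBALLY and with no local input: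
for an elliptic curve `V` over a number field `K`, complementary eigen-summands `M_r ⊓ M_{r'} = ⊥`, `M_r ⊔ M_{r'} = ⊤` of a `K`-rational
endomorphism, `r − r'` a unit, an equivariant `f₀` acting as `r`/`r'` on the two summands (e.g. `π` itself, `eigen_of_endRing`), and the
equivariant projectors `e`, `e'` (p662922):
* `resH1Hom_subtype_proj_mem_map_resSubgroup_range_kummer` — for `y₀ ∈ range κ = ker(H¹(K,E[p^∞]) → H¹(K,E))` (`range_kummerMapPInfty`):
  **`ι_* e_* (res_⊤ y₀) ∈ res_⊤(range κ)`** — the proof of p667915's `resH1Hom_subtype_proj_mem_map_resSubgroup_selmer` verbatim with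
  `Sel_{p^∞}` replaced by `range κ`: `ι_* e_* y = b • ((f₀)_* y − N₂ • y)` (Bézout on the two eigen relations, p666248) and `(f₀)_*` preserves
  `ker primaryH1ToH1` by naturality (`primaryH1ToH1_galH1PrimaryMap`) — NO `HasLocalPointsMaps` needed here;
* `proj_resSubgroup_mem_comap_kummer` — hence `e_* (res_⊤ y₀) ∈ Q_M`, and `zsmul_proj_resSubgroup_mem_comap_kummer` — so is every integer multiple;
* `proj_resSubgroup_kummer_mem_comap_kummer_two` — the road-α instance (`f₀ = π`, `r' = 1 − r`, `p = 2`; projector from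
  `exists_eigenProjector`): for every `t ∈ E(K) ⊗ ℚ₂/ℤ₂` and `M : ℤ`, `M • e_* res_⊤ κ(t) ∈ Q_M`.
So `Q_M ⊇ e_*(res_⊤(range κ))`; with `e_* ι_* = id` this is `Q_M = e_*(res_⊤(range κ))` (the summand's Kummer image IS the projection of the curve's).

References: A. Agboola, Compositio 143 (2007) §6 Prop. 6.11 [Agboola2007]; K. Rubin, LNM 1716 (1999) §2 [Rubin1999]; R. Greenberg, LNM 1716 (1999)
§2 p. 62 (the `p^∞` Kummer map) [GreenbergLNM1716].
-/

noncomputable section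

open scoped Classical TensorProduct

set_option linter.dupNamespace false -- `Summit.BirchSwinnertonDyer.BirchSwinnertonDyer` (summit = problem) is the tree's layout
set_option autoImplicit false

open NumberField IsDedekindDomain Field WeierstrassCurve
open Literature.NumberTheory.EllipticCurves Literature.NumberTheory.EllipticCurves.GreenbergSelmer
open Literature.NumberTheory.EllipticCurves.Castella2018.AcSelmer
open Literature.NumberTheory.EllipticCurves.Agboola2007
open Literature.NumberTheory.EllipticCurves.ResKernel
open Literature.NumberTheory.GaloisRepresentations

universe u

namespace Summit.BirchSwinnertonDyer.BirchSwinnertonDyer.Theorems.PrintCf2.RestrictedSelmerPair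

section KummerEigen

variable {K : Type u} [Field K] [NumberField K] (V : WeierstrassCurve K) [V.IsElliptic] (p : ℕ) [Fact p.Prime]
  (π : V.endRing) (r r' : ℤ_[p])
  (f₀ : V.geomPoints →+ V.geomPoints) (hf₀ : ∀ (σ : absoluteGaloisGroup K) (P : V.geomPoints), f₀ (σ • P) = σ • f₀ P)
  (hfr : ∀ (k : ℕ) (N : ℤ) (x : V.geomPrimaryTorsion p), x ∈ V.endEigenPrimaryTorsion p π r → p ^ k • x = 0 →
    ((N : ℤ_[p]) - r) ∈ (Ideal.span {(p : ℤ_[p]) ^ k} : Ideal ℤ_[p]) → f₀ (x : V.geomPoints) = N • (x : V.geomPoints))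
  (hfr' : ∀ (k : ℕ) (N : ℤ) (x : V.geomPrimaryTorsion p), x ∈ V.endEigenPrimaryTorsion p π r' → p ^ k • x = 0 →
    ((N : ℤ_[p]) - r') ∈ (Ideal.span {(p : ℤ_[p]) ^ k} : Ideal ℤ_[p]) → f₀ (x : V.geomPoints) = N • (x : V.geomPoints))
  (hunit : IsUnit (r - r'))
  (e : V.geomPrimaryTorsion p →+ ↥(V.endEigenPrimaryTorsion p π r))
  (e' : V.geomPrimaryTorsion p →+ ↥(V.endEigenPrimaryTorsion p π r'))
  (he : ∀ (σ : absoluteGaloisGroup K) (x : V.geomPrimaryTorsion p), e (σ • x) = σ • e x)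
  (he' : ∀ (σ : absoluteGaloisGroup K) (x : V.geomPrimaryTorsion p), e' (σ • x) = σ • e' x)
  (hsum : ∀ x, (e x : V.geomPrimaryTorsion p) + (e' x : V.geomPrimaryTorsion p) = x)

include hf₀ hfr hfr' hunit he' hsum in
/-- **The `M_r`-component of a KUMMER class is (the restriction of) a KUMMER class**: for `y₀ ∈ range κ` (`κ = kummerMapPInfty`, range
`= ker(H¹(K, E[p^∞]) → H¹(K, E))` by `range_kummerMapPInfty`), `ι_* e_* (res_⊤ y₀) ∈ res_⊤(range κ)` — `ι_* e_* y = b • ((f₀)_* y − N₂ • y)` with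
`N₂ ≡ r′`, `b (N₁ − N₂) ≡ 1` modulo the exponent of `y₀` (Bézout on the eigen relations of p666248), and `(f₀)_*` preserves `ker primaryH1ToH1` by the
naturality `primaryH1ToH1_galH1PrimaryMap`. (The proof of p667915's Selmer version, with `Sel` replaced by `range κ`; no local points needed.)
[cite: GreenbergLNM1716, §2 p. 62] [cite: Rubin1999, §2] -/
theorem resH1Hom_subtype_proj_mem_map_resSubgroup_range_kummer {y₀ : galH1Primary V p}
    (hy₀ : y₀ ∈ (V.kummerMapPInfty p V.zsmul_geomPoints_surjective_holds).range) :
    resH1Hom (ContinuousMonoidHom.id _) (V.endEigenPrimaryTorsion p π r).subtype (fun _ _ ↦ rfl)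
        (resH1Hom (ContinuousMonoidHom.id _) e (fun σ x ↦ by rw [Subgroup.smul_def, Subgroup.smul_def]; exact he σ x)
          (resSubgroup (⊤ : Subgroup (absoluteGaloisGroup K)) (V.geomPrimaryTorsion p) y₀)) ∈
      ((V.kummerMapPInfty p V.zsmul_geomPoints_surjective_holds).range).map
        (resSubgroup (⊤ : Subgroup (absoluteGaloisGroup K)) (V.geomPrimaryTorsion p)) := by
  set R := resSubgroup (⊤ : Subgroup (absoluteGaloisGroup K)) (V.geomPrimaryTorsion p) with hR
  set y := R y₀ with hydef
  set c := resH1Hom (ContinuousMonoidHom.id _) e (fun σ x ↦ by rw [Subgroup.smul_def, Subgroup.smul_def]; exact he σ x) y with hcdef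
  set c' := resH1Hom (ContinuousMonoidHom.id _) e' (fun σ x ↦ by rw [Subgroup.smul_def, Subgroup.smul_def]; exact he' σ x) y with hc'def
  set ιc := resH1Hom (ContinuousMonoidHom.id _) (V.endEigenPrimaryTorsion p π r).subtype (fun _ _ ↦ rfl) c with hιc
  set ιc' := resH1Hom (ContinuousMonoidHom.id _) (V.endEigenPrimaryTorsion p π r').subtype (fun _ _ ↦ rfl) c' with hιc'
  -- exponent of `y₀`
  obtain ⟨J, hJ⟩ := exists_pow_smul_galH1Primary_eq_zero V p y₀
  -- `(f₀)_*` acts as `N₁` on `ιc` and as `N₂` on `ιc′`, both to order `p^J`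
  obtain ⟨N₁, hN₁, h₁⟩ := exists_eigen_resH1Hom_primaryTorsionMap V p π r f₀ hf₀ hfr c J
  obtain ⟨N₂, hN₂, h₂⟩ := exists_eigen_resH1Hom_primaryTorsionMap V p π r' f₀ hf₀ hfr' c' J
  -- the splitting `ιc + ιc′ = y`
  have hsplit : ιc + ιc' = y := resH1Hom_subtype_proj_add_eq V p π r r' ⊤ e e' he he' hsum y
  -- `π^⊤_* y = R ((f₀)_* y₀)`
  have key := ResKernel.resH1Hom_comp_resSubgroup (ContinuousMonoidHom.id (absoluteGaloisGroup K))
    (primaryTorsionMap p f₀) (primaryTorsionMap_smul p f₀ hf₀) ⊤ ⊤ (ContinuousMonoidHom.id _) (fun _ ↦ rfl)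
    (fun σ x ↦ by
      rw [Subgroup.smul_def, Subgroup.smul_def]
      exact primaryTorsionMap_smul p f₀ hf₀ _ x)
  have hRy : resH1Hom (ContinuousMonoidHom.id _) (primaryTorsionMap p f₀)
      (fun σ x ↦ by
        rw [Subgroup.smul_def, Subgroup.smul_def]
        exact primaryTorsionMap_smul p f₀ hf₀ _ x) y = R (galH1PrimaryMap p f₀ hf₀ y₀) := by
    have h := congrArg (fun g ↦ g y₀) key
    simp only [AddMonoidHom.comp_apply] at h
    rw [hydef]
    exact h
  -- `R((f₀)_* y₀ − N₂ • y₀) = (N₁ − N₂) • ιc`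
  have hmain : R (galH1PrimaryMap p f₀ hf₀ y₀ - (N₂ : ℤ) • y₀) = ((N₁ : ℤ) - N₂) • ιc := by
    rw [map_sub, map_zsmul, ← hRy, ← hydef, ← hsplit, map_add, h₁, h₂, sub_zsmul, zsmul_add, natCast_zsmul, natCast_zsmul,
      natCast_zsmul]
    abel
  -- Bézout: `b (N₁ − N₂) ≡ 1 (mod p^J)` and `p^J • ιc = 0`
  have hcop : IsCoprime ((p : ℤ) ^ J) ((N₁ : ℤ) - N₂) := by
    refine CMPrimes.isCoprime_pow_of_sub_mem_span_of_isUnit hunit ?_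
    have : (((N₁ : ℤ) - N₂ : ℤ) : ℤ_[p]) - (r - r') = (((N₁ : ℤ) : ℤ_[p]) - r) - (((N₂ : ℤ) : ℤ_[p]) - r') := by push_cast; ring
    rw [this]
    exact Ideal.sub_mem _ hN₁ hN₂
  obtain ⟨a, b, hab⟩ := hcop
  have hJc : ((p : ℤ) ^ J) • ιc = 0 := by
    have h0 : p ^ J • y = 0 := by rw [hydef, ← map_nsmul, hJ, map_zero]
    have h1 : p ^ J • ιc = 0 := by rw [hιc, hcdef, ← map_nsmul, ← map_nsmul, h0, map_zero, map_zero]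
    rw [← natCast_zsmul] at h1
    exact_mod_cast h1
  have hιc_eq : ιc = b • R (galH1PrimaryMap p f₀ hf₀ y₀ - (N₂ : ℤ) • y₀) := by
    rw [hmain, ← mul_zsmul]
    calc ιc = (1 : ℤ) • ιc := (one_zsmul ιc).symm
      _ = (a * (p : ℤ) ^ J + b * ((N₁ : ℤ) - N₂)) • ιc := by rw [hab]
      _ = (b * ((N₁ : ℤ) - N₂)) • ιc := by rw [add_zsmul, mul_zsmul, hJc, zsmul_zero, zero_add]
  rw [hιc_eq, ← map_zsmul]
  refine AddSubgroup.mem_map_of_mem _ (AddSubgroup.zsmul_mem _ (AddSubgroup.sub_mem _ ?_ (AddSubgroup.zsmul_mem _ hy₀ _)) _)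
  -- `(f₀)_*` preserves `range κ = ker primaryH1ToH1`
  rw [range_kummerMapPInfty] at hy₀ ⊢
  rw [AddMonoidHom.mem_ker, primaryH1ToH1_galH1PrimaryMap, AddMonoidHom.mem_ker.mp hy₀, map_zero]

include hf₀ hfr hfr' hunit he' hsum in
/-- Hence **`e_* (res_⊤ y₀) ∈ Q_M := ι_*⁻¹(res_⊤(range κ))`** for every `y₀ ∈ range κ`, and so does every integer multiple.
[cite: GreenbergLNM1716, §2 p. 62] [cite: Agboola2007, Prop. 6.11] -/
theorem zsmul_proj_resSubgroup_mem_comap_kummer {y₀ : galH1Primary V p}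
    (hy₀ : y₀ ∈ (V.kummerMapPInfty p V.zsmul_geomPoints_surjective_holds).range) (M : ℤ) :
    M • resH1Hom (ContinuousMonoidHom.id _) e (fun σ x ↦ by rw [Subgroup.smul_def, Subgroup.smul_def]; exact he σ x)
        (resSubgroup (⊤ : Subgroup (absoluteGaloisGroup K)) (V.geomPrimaryTorsion p) y₀) ∈
      (((V.kummerMapPInfty p V.zsmul_geomPoints_surjective_holds).range).map
          (resSubgroup ⊤ (V.geomPrimaryTorsion p))).comap
        (resH1Hom (ContinuousMonoidHom.id _) (V.endEigenPrimaryTorsion p π r).subtype (fun _ _ ↦ rfl)) := by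
  rw [AddSubgroup.mem_comap, map_zsmul]
  exact AddSubgroup.zsmul_mem _
    (resH1Hom_subtype_proj_mem_map_resSubgroup_range_kummer V p π r r' f₀ hf₀ hfr hfr' hunit e e' he he' hsum hy₀) M

end KummerEigen

/-! ## The road-α instance: `f₀ = π`, `r' = 1 − r` -/

section Frame

variable {K : Type u} [Field K] [NumberField K] (V : WeierstrassCurve K) [V.IsElliptic] (p : ℕ) [Fact p.Prime]
  (π : V.endRing) (r : ℤ_[p])

/-- **`M • e_* res_⊤ κ(t) ∈ Q_M` for every `t ∈ E(K) ⊗ ℚ_p/ℤ_p` and every integer `M`**, for the CM endomorphism `π` itself as `f₀`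
(`eigen_of_endRing`), complementary summands `E[𝔮_r^∞] ⊓ E[𝔮_{r'}^∞] = ⊥`, `⊔ = ⊤` with `r − r'` a unit, and ANY equivariant projector `e` onto
`E[𝔮_r^∞]` with `x − e x ∈ E[𝔮_{r'}^∞]`. [cite: GreenbergLNM1716, §2 p. 62] [cite: Agboola2007, Prop. 6.11] -/
theorem zsmul_proj_resSubgroup_kummer_mem_comap_kummer {r' : ℤ_[p]}
    (hinf : V.endEigenPrimaryTorsion p π r ⊓ V.endEigenPrimaryTorsion p π r' = ⊥)
    (hsup : V.endEigenPrimaryTorsion p π r ⊔ V.endEigenPrimaryTorsion p π r' = ⊤) (hunit : IsUnit (r - r'))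
    (e : V.geomPrimaryTorsion p →+ ↥(V.endEigenPrimaryTorsion p π r))
    (hesub : ∀ x, x - (e x : V.geomPrimaryTorsion p) ∈ V.endEigenPrimaryTorsion p π r')
    (he : ∀ (σ : absoluteGaloisGroup K) (x : V.geomPrimaryTorsion p), e (σ • x) = σ • e x)
    (t : V.toAffine.Point ⊗[ℤ] PruferQuot p) (M : ℤ) :
    M • resH1Hom (ContinuousMonoidHom.id _) e (fun σ x ↦ by rw [Subgroup.smul_def, Subgroup.smul_def]; exact he σ x)
        (resSubgroup (⊤ : Subgroup (absoluteGaloisGroup K)) (V.geomPrimaryTorsion p)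
          (V.kummerMapPInfty p V.zsmul_geomPoints_surjective_holds t)) ∈
      (((V.kummerMapPInfty p V.zsmul_geomPoints_surjective_holds).range).map
          (resSubgroup ⊤ (V.geomPrimaryTorsion p))).comap
        (resH1Hom (ContinuousMonoidHom.id _) (V.endEigenPrimaryTorsion p π r).subtype (fun _ _ ↦ rfl)) := by
  obtain ⟨hf₀, hfr⟩ := eigen_of_endRing V p π r
  obtain ⟨-, hfr'⟩ := eigen_of_endRing V p π r'
  obtain ⟨e', he'₁, he'₂, -, he'⟩ := exists_eigenProjector V p π r' r (by rw [inf_comm]; exact hinf) (by rw [sup_comm]; exact hsup)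
  have hsum := coe_proj_add_coe_proj V p π r r' e e' hesub he'₁ he'₂
  exact zsmul_proj_resSubgroup_mem_comap_kummer V p π r r' _ hf₀ hfr hfr' hunit e e' he he' hsum ⟨t, rfl⟩ M

end Frame

end Summit.BirchSwinnertonDyer.BirchSwinnertonDyer.Theorems.PrintCf2.RestrictedSelmerPair

end
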